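import Literature.NumberTheory.Sieve.FGKMT2018ResidueClassCount
import Literature.NumberTheory.Sieve.Maynard2016SystemCRT
import HarnessLib

/-!
# FGKMT 2018 §7 / Maynard 2016 Prop. 9.1: the local class count for `𝒜 = ℤ`

Sources: J. Maynard, *Dense clusters of primes in subsets*, Compositio Math. 152 (2016) =
arXiv:1405.2593 [Maynard2016DenseClusters], proof of Proposition 9.1 p. 19 («we consider the
summation over `n` in the residue class `v₀ (mod W)` … if `(∏ L_i(v₀), W) ≠ 1` then `w_n = 0` … we can
combine the congruence conditions by the Chinese remainder theorem, and see that the inner sum is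
`#𝒜(x; q, a)` for some `a` and `q = W[d, e]`»), proof of Proposition 9.2 p. 21 (the same with
`#𝒫_{L_m}(x; q, a)`); K. Ford, B. Green, S. Konyagin, J. Maynard, T. Tao, *Long gaps between primes*,
JAMS 31 (2018) = arXiv:1412.5029v4 [FordGreenKonyaginMaynardTao2018], §7 pp. 20–21 (Hypothesis 1
(1),(3) are trivial for `𝒜 = ℤ`; the weights (7.9) with the cut `(L_i(n), W) = 1`).

PROVED here (no named facts), for the pinned data of `FGKMT2018MultidimensionalSieve`:

* `abs_card_filter_dyadZ_periodic_sub_le` — for a `q`-periodic condition `Q` on `ℤ` with `N`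
  admissible classes mod `q`: `|#{n ∈ 𝒜(X) : Q n} − #𝒜(X)·N/q| ≤ N` (from
  `abs_card_dyadZ_modEq_sub_div_le`, class by class);
* `wCoprime_iff_forall_prime` and `card_range_filter_wCoprime` — the `W`-cut
  `(L_i(n), W) = 1 ∀ i` depends on `n mod W` and admits exactly `∏_{p ∣ W} (p − ω_𝓛(p))` classes
  (`W` squarefree; `ω_𝓛(p) = #{n mod p : p ∣ ∏ L_i(n)}` = `omegaL`);
* `card_range_filter_dvd_formEval_eq_one` — `m ∣ L(n) = a n + b` has exactly one solution mod `m`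
  when `(a, m) = 1`;
* `card_range_filter_localSystem` — for moduli `m_i` pairwise coprime, coprime to `W` and to `a_i`:
  the system `(L_i(n), W) = 1, m_i ∣ L_i(n) ∀ i` admits exactly `∏_{p ∣ W}(p − ω(p))` classes
  mod `W ∏ m_i` (CRT, `Maynard2016.card_filter_range_prod_of_pairwise_coprime`);
* `abs_card_dyadZ_localSystem_sub_le` — hence
  `|#{n ∈ 𝒜(X) : (L_i(n), W) = 1, m_i ∣ L_i(n) ∀ i} − #𝒜(X) φ_ω(W)/(W ∏ m_i)| ≤ φ_ω(W)`,
  the inner count of [Maynard, (9.1)] summed over the `W`-classes `v₀` (moduli `m_i = [d_i, e_i]`).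

## References
* J. Maynard, *Dense clusters of primes in subsets*, Compositio Math. 152 (2016), proofs of
  Props. 9.1, 9.2 [Maynard2016DenseClusters].
* K. Ford, B. Green, S. Konyagin, J. Maynard, T. Tao, *Long gaps between primes*, JAMS 31 (2018),
  §7 [FordGreenKonyaginMaynardTao2018].
-/

noncomputable section

open Finset

namespace Literature.NumberTheory.Sieve.FGKMT2018

variable {k : ℕ}

/-! ### Periodic conditions on `𝒜(X) ⊂ ℤ` -/

/-- **Class-by-class count of a periodic condition on `𝒜(X)`.** If `Q` is `q`-periodic on `ℤ`
(`q ≥ 1`) and `N = #{0 ≤ r < q : Q r}`, then `|#{n ∈ 𝒜(X) : Q n} − #𝒜(X) N/q| ≤ N`.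
[cite: FordGreenKonyaginMaynardTao2018, §7 p. 20 (Hypothesis 1 (1) for 𝒜 = ℤ); Maynard2016DenseClusters, proof of Prop. 9.1 p. 19] -/
theorem abs_card_filter_dyadZ_periodic_sub_le (X : ℝ) {q : ℕ} (hq : 0 < q) (Q : ℤ → Prop)
    [DecidablePred Q] (hQ : ∀ n t : ℤ, Q (n + q * t) ↔ Q n) :
    |(#((dyadZ X).filter Q) : ℝ) -
        (#(dyadZ X) : ℝ) * #((Finset.range q).filter fun r : ℕ => Q r) / q| ≤
      #((Finset.range q).filter fun r : ℕ => Q r) := by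
  classical
  set N := (Finset.range q).filter fun r : ℕ => Q r with hN
  have hqZ : (q : ℤ) ≠ 0 := by exact_mod_cast hq.ne'
  have hqZ' : (0 : ℤ) < q := by exact_mod_cast hq
  -- reduction of `n` to its class representative
  have hmodQ : ∀ n : ℤ, Q (n % q) ↔ Q n := by
    intro n
    have e : n % q = n + q * (-(n / q)) := by rw [Int.emod_def]; ring
    rw [e]; exact hQ n _
  set f : ℤ → ℕ := fun n => (n % q).toNat with hf
  have hf_cast : ∀ n : ℤ, ((f n : ℕ) : ℤ) = n % q := fun n =>
    Int.toNat_of_nonneg (Int.emod_nonneg n hqZ)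
  have hf_lt : ∀ n : ℤ, f n < q := by
    intro n
    have h1 : ((f n : ℕ) : ℤ) < q := by rw [hf_cast]; exact Int.emod_lt_of_pos n hqZ'
    exact_mod_cast h1
  have Hmap : ∀ n ∈ (dyadZ X).filter Q, f n ∈ N := by
    intro n hn
    refine Finset.mem_filter.2 ⟨Finset.mem_range.2 (hf_lt n), ?_⟩
    rw [hf_cast]
    exact (hmodQ n).2 (Finset.mem_filter.1 hn).2
  have hsplit := Finset.card_eq_sum_card_fiberwise Hmap
  have hfiber : ∀ r ∈ N, ((dyadZ X).filter Q).filter (fun n => f n = r) =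
      (dyadZ X).filter fun n : ℤ => n ≡ (r : ℤ) [ZMOD (q : ℤ)] := by
    intro r hr
    obtain ⟨hrq, hQr⟩ := Finset.mem_filter.1 hr
    have hrq' : (r : ℤ) % q = r :=
      Int.emod_eq_of_lt (by exact_mod_cast Nat.zero_le r) (by exact_mod_cast Finset.mem_range.1 hrq)
    ext n
    simp only [Finset.mem_filter]
    constructor
    · rintro ⟨⟨hn, -⟩, hfn⟩
      refine ⟨hn, ?_⟩
      show n % q = (r : ℤ) % q
      rw [hrq', ← hf_cast n, hfn]
    · rintro ⟨hn, hmod⟩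
      have e : n % q = r := by rw [hmod.eq, hrq']
      refine ⟨⟨hn, ?_⟩, ?_⟩
      · rw [← hmodQ n, e]; exact hQr
      · have : ((f n : ℕ) : ℤ) = r := by rw [hf_cast, e]
        exact_mod_cast this
  have hsum : (#((dyadZ X).filter Q) : ℝ) =
      ∑ r ∈ N, (#((dyadZ X).filter fun n : ℤ => n ≡ (r : ℤ) [ZMOD (q : ℤ)]) : ℝ) := by
    rw [hsplit]; push_cast
    exact Finset.sum_congr rfl fun r hr => by rw [hfiber r hr]
  have hrw : (#(dyadZ X) : ℝ) * #N / q = ∑ r ∈ N, (#(dyadZ X) : ℝ) / q := by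
    rw [Finset.sum_const, nsmul_eq_mul]; ring
  rw [hsum, hrw, ← Finset.sum_sub_distrib]
  refine (Finset.abs_sum_le_sum_abs _ _).trans ?_
  calc ∑ r ∈ N, |(#((dyadZ X).filter fun n : ℤ => n ≡ (r : ℤ) [ZMOD (q : ℤ)]) : ℝ) -
          (#(dyadZ X) : ℝ) / q|
      ≤ ∑ r ∈ N, (1 : ℝ) :=
        Finset.sum_le_sum fun r _ => abs_card_dyadZ_modEq_sub_div_le X hq r
    _ = #N := by simp

/-! ### The `W`-cut -/

/-- `L(n + c) = L(n) + a c`. [cite: FordGreenKonyaginMaynardTao2018, §7 p. 20 (linear forms)] -/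
theorem formEval_add (l : ℤ × ℤ) (n c : ℤ) : formEval l (n + c) = formEval l n + l.1 * c := by
  unfold formEval; ring

/-- `gcd(x + W t, W) = gcd(x, W)`. [cite: FordGreenKonyaginMaynardTao2018, (7.9) p. 21 (the cut (L_i(n), W) = 1 depends on n mod W)] -/
theorem intGcd_add_mul_self (x t : ℤ) (W : ℕ) : Int.gcd (x + W * t) W = Int.gcd x W := by
  apply Nat.dvd_antisymm
  · have h1 : ((Int.gcd (x + W * t) W : ℕ) : ℤ) ∣ x + W * t := Int.gcd_dvd_left ..
    have h2 : ((Int.gcd (x + W * t) W : ℕ) : ℤ) ∣ (W : ℤ) := Int.gcd_dvd_right ..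
    have h3 : ((Int.gcd (x + W * t) W : ℕ) : ℤ) ∣ x := by
      simpa using (dvd_sub h1 (Dvd.dvd.mul_right h2 t))
    exact Int.dvd_gcd h3 h2
  · have h1 : ((Int.gcd x W : ℕ) : ℤ) ∣ x := Int.gcd_dvd_left ..
    have h2 : ((Int.gcd x W : ℕ) : ℤ) ∣ (W : ℤ) := Int.gcd_dvd_right ..
    have h3 : ((Int.gcd x W : ℕ) : ℤ) ∣ x + W * t := dvd_add h1 (Dvd.dvd.mul_right h2 t)
    exact Int.dvd_gcd h3 h2

/-- The `W`-cut `(L_i(n), W) = 1 ∀ i` holds iff no prime `p ∣ W` divides `∏ L_i(n)`.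
[cite: Maynard2016DenseClusters, proof of Prop. 9.1 p. 19 («if (∏ L_i(v₀), W) ≠ 1 then w_n = 0»)] -/
theorem wCoprime_iff_forall_prime (L : Fin k → ℤ × ℤ) {W : ℕ} (hW : W ≠ 0) (n : ℤ) :
    (∀ i, Int.gcd (formEval (L i) n) W = 1) ↔
      ∀ p ∈ W.primeFactors, ¬ (p : ℤ) ∣ ∏ i, formEval (L i) n := by
  constructor
  · intro h p hp hdvd
    have hpP : p.Prime := Nat.prime_of_mem_primeFactors hp
    have hpW : p ∣ W := Nat.dvd_of_mem_primeFactors hp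
    have hpZ : Prime (p : ℤ) := Nat.prime_iff_prime_int.1 hpP
    obtain ⟨i, -, hi⟩ := (Prime.dvd_finsetProd_iff hpZ _).1 hdvd
    have hg : p ∣ Int.gcd (formEval (L i) n) W := Int.dvd_gcd hi (Int.natCast_dvd_natCast.2 hpW)
    rw [h i] at hg
    exact hpP.ne_one (Nat.dvd_one.1 hg)
  · intro h i
    by_contra hne
    obtain ⟨p, hpP, hpg⟩ := Nat.exists_prime_and_dvd hne
    have hgW : Int.gcd (formEval (L i) n) W ∣ W := Int.gcd_dvd_natAbs_right _ _  -- gcd ∣ natAbs W = W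
    have hpW : p ∣ W := hpg.trans (by simpa using hgW)
    have hp : p ∈ W.primeFactors := Nat.mem_primeFactors.2 ⟨hpP, hpW, hW⟩
    refine h p hp ?_
    have hgL : ((Int.gcd (formEval (L i) n) W : ℕ) : ℤ) ∣ formEval (L i) n := Int.gcd_dvd_left ..
    exact ((Int.natCast_dvd_natCast.2 hpg).trans hgL).trans (Finset.dvd_prod_of_mem _ (Finset.mem_univ i))

/-- Divisibility of `∏ L_i(n)` by `p` depends on `n mod p`. [cite: FordGreenKonyaginMaynardTao2018, §7 p. 21 (ω_𝓛(p) counts n mod p)] -/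
theorem prime_dvd_prod_formEval_add_mul (L : Fin k → ℤ × ℤ) (p : ℕ) (n t : ℤ) :
    (p : ℤ) ∣ ∏ i, formEval (L i) (n + p * t) ↔ (p : ℤ) ∣ ∏ i, formEval (L i) n := by
  have hmod : (∏ i, formEval (L i) (n + p * t)) ≡ ∏ i, formEval (L i) n [ZMOD (p : ℤ)] := by
    refine Int.ModEq.prod fun i _ => ?_
    rw [formEval_add]
    calc formEval (L i) n + (L i).1 * (p * t)
        ≡ formEval (L i) n + 0 [ZMOD (p : ℤ)] :=
          Int.ModEq.add_left _ (Int.modEq_zero_iff_dvd.2 (Dvd.intro ((L i).1 * t) (by ring)))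
      _ = formEval (L i) n := add_zero _
  rw [Int.dvd_iff_emod_eq_zero, Int.dvd_iff_emod_eq_zero, hmod.eq]

/-- `#{0 ≤ n < p : p ∤ ∏ L_i(n)} = p − ω_𝓛(p)`. [cite: FordGreenKonyaginMaynardTao2018, §7 p. 21 (definition of ω_𝓛(p))] -/
theorem card_range_filter_not_dvd_prod (L : Fin k → ℤ × ℤ) (p : ℕ) :
    #((Finset.range p).filter fun n : ℕ => ¬ (p : ℤ) ∣ ∏ i, formEval (L i) n) = p - omegaL L p := by
  have h := Finset.card_filter_add_card_filter_not
    (s := Finset.range p) (fun n : ℕ => (p : ℤ) ∣ ∏ i, formEval (L i) n)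
  rw [Finset.card_range] at h
  unfold omegaL
  omega

/-- **The `W`-classes.** For squarefree `W`, the cut `(L_i(n), W) = 1 ∀ i` admits exactly
`∏_{p ∣ W} (p − ω_𝓛(p))` residues `n mod W`.
[cite: Maynard2016DenseClusters, proof of Prop. 9.1 p. 19 (summation over v₀ mod W with (∏ L_i(v₀), W) = 1); FordGreenKonyaginMaynardTao2018, (7.8)–(7.9) p. 21] -/
theorem card_range_filter_wCoprime (L : Fin k → ℤ × ℤ) {W : ℕ} (hW : Squarefree W) :
    #((Finset.range W).filter fun n : ℕ => ∀ i, Int.gcd (formEval (L i) n) W = 1) =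
      ∏ p ∈ W.primeFactors, (p - omegaL L p) := by
  classical
  have hW0 : W ≠ 0 := hW.ne_zero
  have hprod : ∏ p ∈ W.primeFactors, p = W := Nat.prod_primeFactors_of_squarefree hW
  have key := Maynard2016.card_filter_range_prod_of_pairwise_coprime W.primeFactors (fun p => p)
    (fun p (n : ℕ) => ¬ (p : ℤ) ∣ ∏ i, formEval (L i) n)
    (fun p hp => (Nat.prime_of_mem_primeFactors hp).pos)
    (fun p hp q hq hpq => (Nat.coprime_primes (Nat.prime_of_mem_primeFactors hp)
      (Nat.prime_of_mem_primeFactors hq)).2 hpq)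
    (fun p _ n => by
      show (¬ (p : ℤ) ∣ ∏ i, formEval (L i) ((n + p : ℕ) : ℤ)) =
        ¬ (p : ℤ) ∣ ∏ i, formEval (L i) (n : ℤ)
      have e : ((n + p : ℕ) : ℤ) = (n : ℤ) + p * 1 := by push_cast; ring
      rw [e, prime_dvd_prod_formEval_add_mul])
  rw [hprod] at key
  rw [← Finset.prod_congr rfl fun p _ => card_range_filter_not_dvd_prod L p, ← key]
  congr 1
  ext n
  simp only [Finset.mem_filter, Finset.mem_range, and_congr_right_iff]
  intro _
  exact wCoprime_iff_forall_prime L hW0 n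

/-! ### One linear congruence -/

/-- **`m ∣ a n + b` has exactly one solution `n mod m` when `(a, m) = 1`.**
[cite: Maynard2016DenseClusters, proof of Prop. 9.1 p. 19 («combine the congruence conditions by the Chinese remainder theorem … #𝒜(x; q, a) for some a»)] -/
theorem card_range_filter_dvd_formEval_eq_one (l : ℤ × ℤ) {m : ℕ} (hm : 0 < m)
    (h : Int.gcd l.1 m = 1) :
    #((Finset.range m).filter fun n : ℕ => (m : ℤ) ∣ formEval l n) = 1 := by
  classical
  have hmZ : (m : ℤ) ≠ 0 := by exact_mod_cast hm.ne'
  have hmZ' : (0 : ℤ) < m := by exact_mod_cast hm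
  -- Bezout: a x ≡ 1 (mod m)
  have hbez : (1 : ℤ) = l.1 * Int.gcdA l.1 m + m * Int.gcdB l.1 m := by
    have := Int.gcd_eq_gcd_ab l.1 m
    rw [h, Nat.cast_one] at this
    exact this
  set x : ℤ := Int.gcdA l.1 m with hx
  set r₀ : ℤ := (-l.2 * x) % m with hr₀
  have hr₀0 : 0 ≤ r₀ := Int.emod_nonneg _ hmZ
  have hr₀m : r₀ < m := Int.emod_lt_of_pos _ hmZ'
  have hsol : (m : ℤ) ∣ formEval l r₀ := by
    -- a r₀ + b ≡ a(−b x) + b = b (1 − a x) = b m gcdB ≡ 0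
    have e1 : (m : ℤ) ∣ r₀ - -l.2 * x :=
      Dvd.intro (-(-l.2 * x / m)) (by rw [hr₀, Int.emod_def]; ring)
    have e2 : formEval l r₀ = l.1 * (r₀ - -l.2 * x) + l.2 * (m * Int.gcdB l.1 m) := by
      unfold formEval
      have : l.2 = l.2 * (l.1 * Int.gcdA l.1 m + m * Int.gcdB l.1 m) := by rw [← hbez, mul_one]
      rw [hx]; linear_combination this
    rw [e2]
    exact dvd_add (e1.mul_left _) ((Dvd.intro (Int.gcdB l.1 m) rfl).mul_left _)
  have huniq : ∀ n n' : ℤ, (m : ℤ) ∣ formEval l n → (m : ℤ) ∣ formEval l n' → (m : ℤ) ∣ n - n' := by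
    intro n n' hn hn'
    have hd : (m : ℤ) ∣ l.1 * (n - n') := by
      have e : l.1 * (n - n') = formEval l n - formEval l n' := by unfold formEval; ring
      rw [e]; exact dvd_sub hn hn'
    exact Int.dvd_of_dvd_mul_right_of_gcd_one hd (by rw [Int.gcd_comm]; exact_mod_cast h)
  refine Finset.card_eq_one.2 ⟨r₀.toNat, ?_⟩
  ext n
  simp only [Finset.mem_filter, Finset.mem_range, Finset.mem_singleton]
  have hcast : ((r₀.toNat : ℕ) : ℤ) = r₀ := Int.toNat_of_nonneg hr₀0
  constructor
  · rintro ⟨hn, hdvd⟩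
    have hd := huniq n r₀ hdvd hsol
    have hlt : |(n : ℤ) - r₀| < m := by
      rw [abs_lt]; constructor <;> [linarith [(Nat.cast_nonneg n : (0 : ℤ) ≤ n)]; (push_cast; linarith [(by exact_mod_cast hn : (n : ℤ) < m)])]
    have h0 : (n : ℤ) - r₀ = 0 := Int.eq_zero_of_abs_lt_dvd hd hlt
    have : (n : ℤ) = r₀.toNat := by rw [hcast]; linarith
    exact_mod_cast this
  · rintro rfl
    refine ⟨?_, by rw [hcast]; exact hsol⟩
    have : ((r₀.toNat : ℕ) : ℤ) < m := by rw [hcast]; exact hr₀m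
    exact_mod_cast this

/-! ### The local system `(L_i(n), W) = 1`, `m_i ∣ L_i(n)` -/

/-- Divisibility `m ∣ L(n)` depends on `n mod m`. [cite: Maynard2016DenseClusters, proof of Prop. 9.1 p. 19] -/
theorem dvd_formEval_add_mul (l : ℤ × ℤ) (m : ℕ) (n t : ℤ) :
    (m : ℤ) ∣ formEval l (n + m * t) ↔ (m : ℤ) ∣ formEval l n := by
  rw [formEval_add, show l.1 * ((m : ℤ) * t) = m * (l.1 * t) by ring]
  exact dvd_add_left (Dvd.intro (l.1 * t) rfl)  -- a ∣ b → (a ∣ c + b ↔ a ∣ c)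

/-- **Classes of the local system.** For `W` squarefree and moduli `m_i ≥ 1` pairwise coprime,
coprime to `W` and with `(a_i, m_i) = 1`: the conditions `(L_i(n), W) = 1 ∀ i` and `m_i ∣ L_i(n) ∀ i`
admit exactly `∏_{p ∣ W} (p − ω_𝓛(p))` residues `n mod W ∏ m_i`.
[cite: Maynard2016DenseClusters, proof of Prop. 9.1 p. 19 («combine the congruence conditions by the Chinese remainder theorem»); FordGreenKonyaginMaynardTao2018, (7.5), (7.9) p. 21] -/
theorem card_range_filter_localSystem (L : Fin k → ℤ × ℤ) {W : ℕ} (hW : Squarefree W)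
    (m : Fin k → ℕ) (hm : ∀ i, 0 < m i) (hmW : ∀ i, (m i).Coprime W)
    (hmm : Pairwise fun i j => (m i).Coprime (m j)) (ham : ∀ i, Int.gcd (L i).1 (m i) = 1) :
    #((Finset.range (W * ∏ i, m i)).filter fun n : ℕ =>
        (∀ i, Int.gcd (formEval (L i) n) W = 1) ∧ ∀ i, ((m i : ℕ) : ℤ) ∣ formEval (L i) n) =
      ∏ p ∈ W.primeFactors, (p - omegaL L p) := by
  classical
  have hW0 : 0 < W := Nat.pos_of_ne_zero hW.ne_zero
  have hM : 0 < ∏ i, m i := Finset.prod_pos fun i _ => hm i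
  have hcop : W.Coprime (∏ i, m i) := Nat.Coprime.prod_right fun i _ => (hmW i).symm
  -- periodicity of the two blocks
  have hQ : Function.Periodic (fun n : ℕ => ∀ i, Int.gcd (formEval (L i) n) W = 1) W := by
    intro n
    refine propext (forall_congr' fun i => ?_)
    have e : ((n + W : ℕ) : ℤ) = (n : ℤ) + W * 1 := by push_cast; ring
    rw [e, formEval_add, show (L i).1 * ((W : ℤ) * 1) = W * (L i).1 by ring, intGcd_add_mul_self]
  have hR : Function.Periodic (fun n : ℕ => ∀ i, ((m i : ℕ) : ℤ) ∣ formEval (L i) n) (∏ i, m i) := by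
    have h := Maynard2016.periodic_forall_of_dvd (Finset.univ : Finset (Fin k)) m
      (fun i (n : ℕ) => ((m i : ℕ) : ℤ) ∣ formEval (L i) n) (M := ∏ i, m i)
      (fun i _ n => by
        have e : ((n + m i : ℕ) : ℤ) = (n : ℤ) + (m i : ℕ) * 1 := by push_cast; ring
        show (((m i : ℕ) : ℤ) ∣ formEval (L i) ((n + m i : ℕ) : ℤ)) =
          (((m i : ℕ) : ℤ) ∣ formEval (L i) (n : ℤ))
        rw [e, dvd_formEval_add_mul])
      (fun i _ => Finset.dvd_prod_of_mem _ (Finset.mem_univ i))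
    intro n
    have := h n
    simp only [Finset.mem_univ, forall_true_left] at this
    exact this
  rw [Maynard2016.card_filter_range_mul_of_coprime hW0 hM hcop _ _ hQ hR,
    card_range_filter_wCoprime L hW]
  -- the system block has exactly one class
  have hsys : #((Finset.range (∏ i, m i)).filter fun n : ℕ =>
      ∀ i, ((m i : ℕ) : ℤ) ∣ formEval (L i) n) = 1 := by
    have key := Maynard2016.card_filter_range_prod_of_pairwise_coprime
      (Finset.univ : Finset (Fin k)) m (fun i (n : ℕ) => ((m i : ℕ) : ℤ) ∣ formEval (L i) n)
      (fun i _ => hm i) (by rw [Finset.coe_univ]; exact Set.pairwise_univ.2 hmm)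
      (fun i _ n => by
        have e : ((n + m i : ℕ) : ℤ) = (n : ℤ) + (m i : ℕ) * 1 := by push_cast; ring
        show (((m i : ℕ) : ℤ) ∣ formEval (L i) ((n + m i : ℕ) : ℤ)) =
          (((m i : ℕ) : ℤ) ∣ formEval (L i) (n : ℤ))
        rw [e, dvd_formEval_add_mul])
    rw [Finset.prod_eq_one (fun i _ => card_range_filter_dvd_formEval_eq_one (L i) (hm i) (ham i))]
      at key
    rw [← key]
    congr 1
    ext n
    simp only [Finset.mem_filter, Finset.mem_univ, forall_true_left]
  rw [hsys, mul_one]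

/-- `ω_𝓛(p) ≤ p`. [cite: FordGreenKonyaginMaynardTao2018, §7 p. 21 (ω_𝓛(p) counts residues mod p)] -/
theorem omegaL_le (L : Fin k → ℤ × ℤ) (p : ℕ) : omegaL L p ≤ p := by
  unfold omegaL
  exact (Finset.card_filter_le _ _).trans (Finset.card_range p).le

/-- `∏_{p ∣ W} (p − ω_𝓛(p)) = φ_ω(W)` (cast to `ℝ`). [cite: FordGreenKonyaginMaynardTao2018, (7.8) p. 21] -/
theorem cast_prod_sub_omegaL (L : Fin k → ℤ × ℤ) (W : ℕ) :
    ((∏ p ∈ W.primeFactors, (p - omegaL L p) : ℕ) : ℝ) = phiOmega L W := by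
  unfold phiOmega
  push_cast [Nat.cast_sub (omegaL_le L _)]
  rfl

/-- **The local class count for `𝒜 = ℤ`** ([Maynard, (9.1)] summed over the classes `v₀ mod W`):
for `W` squarefree and moduli `m_i ≥ 1` pairwise coprime, coprime to `W`, with `(a_i, m_i) = 1`,
`|#{n ∈ 𝒜(X) : (L_i(n), W) = 1, m_i ∣ L_i(n) ∀ i} − #𝒜(X) φ_ω(W)/(W ∏ m_i)| ≤ φ_ω(W)`.
[cite: Maynard2016DenseClusters, proof of Prop. 9.1 p. 19, display (9.1) and «the inner sum is #𝒜(x;q,a) … q = W[d,e]»; FordGreenKonyaginMaynardTao2018, §7 p. 20 (Hypothesis 1 (1) for 𝒜 = ℤ)] -/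
theorem abs_card_dyadZ_localSystem_sub_le (X : ℝ) (L : Fin k → ℤ × ℤ) {W : ℕ} (hW : Squarefree W)
    (m : Fin k → ℕ) (hm : ∀ i, 0 < m i) (hmW : ∀ i, (m i).Coprime W)
    (hmm : Pairwise fun i j => (m i).Coprime (m j)) (ham : ∀ i, Int.gcd (L i).1 (m i) = 1) :
    |(#((dyadZ X).filter fun n : ℤ =>
          (∀ i, Int.gcd (formEval (L i) n) W = 1) ∧ ∀ i, ((m i : ℕ) : ℤ) ∣ formEval (L i) n) : ℝ) -
        (#(dyadZ X) : ℝ) * phiOmega L W / ((W : ℝ) * ∏ i, (m i : ℝ))| ≤ phiOmega L W := by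
  classical
  have hW0 : 0 < W := Nat.pos_of_ne_zero hW.ne_zero
  have hM : 0 < ∏ i, m i := Finset.prod_pos fun i _ => hm i
  have hq : 0 < W * ∏ i, m i := Nat.mul_pos hW0 hM
  have hper : ∀ n t : ℤ,
      ((∀ i, Int.gcd (formEval (L i) (n + ((W * ∏ i, m i : ℕ) : ℤ) * t)) W = 1) ∧
          ∀ i, ((m i : ℕ) : ℤ) ∣ formEval (L i) (n + ((W * ∏ i, m i : ℕ) : ℤ) * t)) ↔
        ((∀ i, Int.gcd (formEval (L i) n) W = 1) ∧ ∀ i, ((m i : ℕ) : ℤ) ∣ formEval (L i) n) := by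
    intro n t
    refine and_congr (forall_congr' fun i => ?_) (forall_congr' fun i => ?_)
    · have e : (n + ((W * ∏ i, m i : ℕ) : ℤ) * t) = n + W * ((∏ i, m i : ℕ) * t) := by
        push_cast; ring
      rw [e, formEval_add, show (L i).1 * ((W : ℤ) * _) = W * ((L i).1 * ((∏ i, m i : ℕ) * t))
        by ring, intGcd_add_mul_self]
    · obtain ⟨c, hc⟩ : m i ∣ W * ∏ j, m j :=
        (Finset.dvd_prod_of_mem _ (Finset.mem_univ i)).mul_left W
      have e : (n + ((W * ∏ i, m i : ℕ) : ℤ) * t) = n + (m i : ℕ) * ((c : ℤ) * t) := by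
        rw [hc]; push_cast; ring
      rw [e, dvd_formEval_add_mul]
  have h := abs_card_filter_dyadZ_periodic_sub_le X hq
    (fun n : ℤ => (∀ i, Int.gcd (formEval (L i) n) W = 1) ∧ ∀ i, ((m i : ℕ) : ℤ) ∣ formEval (L i) n)
    hper
  rw [card_range_filter_localSystem L hW m hm hmW hmm ham, cast_prod_sub_omegaL] at h
  have e : ((W * ∏ i, m i : ℕ) : ℝ) = (W : ℝ) * ∏ i, (m i : ℝ) := by push_cast; rfl
  rw [e] at h
  exact h

end Literature.NumberTheory.Sieve.FGKMT2018
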